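import Summits.AtomisticToContinuum.Crystallization.Theorems.OverbindingBudgetElasticSplitDilation
import Summits.AtomisticToContinuum.Crystallization.Theorems.OverbindingBudgetCubeTails

/-!
# OverbindingBudget — the local relaxation test, I: the cut and the abstract superposition estimate (lens-4 g28)

Piece LRT `LocalRelaxationTest (1/250) 10` of the elastic split (`…ElasticSplitStatements`, cone `rdef_of_grossU_shearSplit_record` on
RDEF stmt-31280): a texture of the clean class that is NOT locally optimal has strained cubes.
Cut (glue PROVED, `localRelaxationTest_of`):  LRT ⟸ `ImprovementRecurrence` (one improving surgery ⟹ a uniformly dense family of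
improving surgeries with a uniform gain and support radius — recurrence transfer + continuity of the gain) ∧ `SurgerySuperposition`
(a uniformly dense family of improving surgeries in a uniformly discrete texture ⟹ `StrainedCubes κ` for some `κ > 0`).
§2–§4: exact bookkeeping of a disjoint family of count-preserving surgeries inside a finite `F ⊆ Y` (`selfEnergy_family_sub`,
`finiteGain_eq`) and the abstract estimate `superpose_estimate` (`E(#F) + #cells · g/2 ≤ U(F)` once tails and cross rows fit in `g/2`).
Part II (`…OverbindingBudgetLocalRelaxation`) runs the cell grid and PROVES `SurgerySuperposition`.
-/

noncomputable section

open Metric Set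
open scoped BigOperators
open Literature.MathematicalPhysics.StatisticalMechanics
open Summit.AtomisticToContinuum.Crystallization.Theorems.OverbindingBudgetEdgeRelaxationStatements
open Summit.AtomisticToContinuum.Crystallization.Theorems.OverbindingBudgetElasticSplitStatements (surgeryGain LocallyOptimal LocalRelaxationTest)
open Summit.AtomisticToContinuum.Crystallization.Theorems.OverbindingBudgetCubeTails
open Summit.AtomisticToContinuum.Crystallization.Theorems.OverbindingBudgetElasticSplitDilation (enum enum_injective interactionEnergy_enum)

namespace Summit.AtomisticToContinuum.Crystallization.Theorems.OverbindingBudgetLocalRelaxationCut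

/-! ## §1  Statements and the cut -/

/-- **`ImprovingPatch g R Y p`**: an improving count-preserving surgery of `Y` supported in the ball `B(p, R)`, releasing `≥ g`:
finite `F ⊆ Y ∩ B(p,R)`, new positions `G ⊆ B(p,R)` off `Y ∖ F`, `#G = #F`, `surgeryGain Y F G ≥ g`. -/
def ImprovingPatch (g R : ℝ) (Y : Set (EuclideanSpace ℝ (Fin 3))) (p : (EuclideanSpace ℝ (Fin 3))) : Prop :=
  ∃ F G : Finset (EuclideanSpace ℝ (Fin 3)), (↑F : Set (EuclideanSpace ℝ (Fin 3))) ⊆ Y ∧ (∀ y ∈ F, dist y p ≤ R) ∧ (∀ x ∈ G, dist x p ≤ R) ∧ G.card = F.card ∧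
    Disjoint (↑G : Set (EuclideanSpace ℝ (Fin 3))) (Y \ ↑F) ∧ g ≤ surgeryGain Y F G

/-- **`DenseImprovement Y`**: improving surgeries with ONE gain `g > 0` and ONE support radius `R` occur within a uniform distance `G`
of every point of space. -/
def DenseImprovement (Y : Set (EuclideanSpace ℝ (Fin 3))) : Prop :=
  ∃ g : ℝ, 0 < g ∧ ∃ R : ℝ, 0 < R ∧ ∃ G : ℝ, 0 ≤ G ∧ ∀ z : (EuclideanSpace ℝ (Fin 3)), ∃ p : (EuclideanSpace ℝ (Fin 3)), dist p z ≤ G ∧ ImprovingPatch g R Y p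

/-- **Piece A `ImprovementRecurrence T₀ D`** (recurrence transfer; TRUE-type, M): in the clean class, ONE improving surgery recurs with
uniform gain, radius and gaps (uniform recurrence moves the patch, continuity of the gain under `ε`-matching keeps half the gain, the
covering radius `9/10` turns «near every site» into «near every point»). -/
def ImprovementRecurrence (T₀ D : ℝ) : Prop :=
  ∀ Y : Set (EuclideanSpace ℝ (Fin 3)), CleanClass T₀ D Y → ¬ LocallyOptimal Y → DenseImprovement Y

/-- **Piece B `SurgerySuperposition`** (PROVED below): dense improving surgeries in a uniformly discrete texture strain the cubes. -/
def SurgerySuperposition : Prop :=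
  ∀ Y : Set (EuclideanSpace ℝ (Fin 3)), UniformlyDiscrete Y → DenseImprovement Y → ∃ κ : ℝ, 0 < κ ∧ StrainedCubes κ Y

/-- the cut: LRT ⟸ A ∧ B. -/
theorem localRelaxationTest_of {T₀ D : ℝ} (hA : ImprovementRecurrence T₀ D) (hB : SurgerySuperposition) :
    LocalRelaxationTest T₀ D :=
  fun Y hW hnot => hB Y hW.1 (hA Y hW hnot)

/-! ## §2  Finite pair energies: algebra of surgeries -/

/-- the interaction sum `I(A, B) = Σ_{a ∈ A} Σ_{b ∈ B} V_LJ(|a − b|)`. -/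
def pairSum (A B : Finset (EuclideanSpace ℝ (Fin 3))) : ℝ := ∑ a ∈ A, ∑ b ∈ B, lennardJones (dist a b)

/-- the self-energy `U(A) = ½ I(A, A)` (the right-hand side of `StrainedCubes`). -/
def selfEnergy (A : Finset (EuclideanSpace ℝ (Fin 3))) : ℝ := 1 / 2 * ∑ a ∈ A, ∑ b ∈ A, lennardJones (dist a b)

/-- `U(A) = ½ I(A, A)`. -/
theorem selfEnergy_eq (A : Finset (EuclideanSpace ℝ (Fin 3))) : selfEnergy A = 1 / 2 * pairSum A A := rfl

/-- symmetry `I(A, B) = I(B, A)`. -/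
theorem pairSum_comm (A B : Finset (EuclideanSpace ℝ (Fin 3))) : pairSum A B = pairSum B A := by
  unfold pairSum
  rw [Finset.sum_comm]
  exact Finset.sum_congr rfl fun b _ => Finset.sum_congr rfl fun a _ => by rw [dist_comm]

/-- additivity in the first slot over a disjoint union. -/
theorem pairSum_union_left {A A' : Finset (EuclideanSpace ℝ (Fin 3))} (h : Disjoint A A') (B : Finset (EuclideanSpace ℝ (Fin 3))) :
    pairSum (A ∪ A') B = pairSum A B + pairSum A' B := by
  unfold pairSum
  exact Finset.sum_union h

/-- additivity in the second slot over a disjoint union. -/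
theorem pairSum_union_right (A : Finset (EuclideanSpace ℝ (Fin 3))) {B B' : Finset (EuclideanSpace ℝ (Fin 3))} (h : Disjoint B B') :
    pairSum A (B ∪ B') = pairSum A B + pairSum A B' := by
  rw [pairSum_comm, pairSum_union_left h, pairSum_comm B, pairSum_comm B']

/-- additivity in the first slot over a disjoint family. -/
theorem pairSum_biUnion_left {ι : Type*} (s : Finset ι) (T : ι → Finset (EuclideanSpace ℝ (Fin 3)))
    (h : (↑s : Set ι).PairwiseDisjoint T) (B : Finset (EuclideanSpace ℝ (Fin 3))) :
    pairSum (s.biUnion T) B = ∑ k ∈ s, pairSum (T k) B := by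
  unfold pairSum
  exact Finset.sum_biUnion h

/-- additivity in the second slot over a disjoint family. -/
theorem pairSum_biUnion_right {ι : Type*} (A : Finset (EuclideanSpace ℝ (Fin 3))) (s : Finset ι) (T : ι → Finset (EuclideanSpace ℝ (Fin 3)))
    (h : (↑s : Set ι).PairwiseDisjoint T) :
    pairSum A (s.biUnion T) = ∑ k ∈ s, pairSum A (T k) := by
  rw [pairSum_comm, pairSum_biUnion_left s T h]
  exact Finset.sum_congr rfl fun k _ => pairSum_comm _ _

/-- self-energy of a disjoint union. -/
theorem selfEnergy_union {A B : Finset (EuclideanSpace ℝ (Fin 3))} (h : Disjoint A B) :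
    selfEnergy (A ∪ B) = selfEnergy A + selfEnergy B + pairSum A B := by
  rw [selfEnergy_eq, selfEnergy_eq, selfEnergy_eq, pairSum_union_left h, pairSum_union_right A h, pairSum_union_right B h,
    pairSum_comm B A]
  ring

/-- self-energy of a disjoint family: `U(⋃ T_k) = Σ_k U(T_k) + ½ Σ_k Σ_{l ≠ k} I(T_k, T_l)`. -/
theorem selfEnergy_biUnion {ι : Type*} [DecidableEq ι] (s : Finset ι) (T : ι → Finset (EuclideanSpace ℝ (Fin 3)))
    (h : (↑s : Set ι).PairwiseDisjoint T) :
    selfEnergy (s.biUnion T) = ∑ k ∈ s, selfEnergy (T k) + 1 / 2 * ∑ k ∈ s, ∑ l ∈ s.erase k, pairSum (T k) (T l) := by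
  rw [selfEnergy_eq, pairSum_biUnion_left s T h]
  have h1 : ∀ k ∈ s, pairSum (T k) (s.biUnion T) = pairSum (T k) (T k) + ∑ l ∈ s.erase k, pairSum (T k) (T l) := by
    intro k hk
    rw [pairSum_biUnion_right _ s T h, ← Finset.add_sum_erase s _ hk]
  rw [Finset.sum_congr rfl h1, Finset.sum_add_distrib]
  simp only [selfEnergy_eq, ← Finset.mul_sum]
  ring

/-- **One surgery family, exact bookkeeping.**  For a rest `Rst` and two disjoint families `F', G'` over `s` with `Rst ⊥ F'_k`, `Rst ⊥ G'_k`: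
`U(Rst ∪ ⋃F') − U(Rst ∪ ⋃G') = Σ_k [U(F'_k) + I(F'_k, Rst) − U(G'_k) − I(G'_k, Rst)] + ½ Σ_k Σ_{l≠k} [I(F'_k,F'_l) − I(G'_k,G'_l)]`. -/
theorem selfEnergy_family_sub {ι : Type*} [DecidableEq ι] (s : Finset ι) (Rst : Finset (EuclideanSpace ℝ (Fin 3))) (F' G' : ι → Finset (EuclideanSpace ℝ (Fin 3)))
    (hF : (↑s : Set ι).PairwiseDisjoint F') (hG : (↑s : Set ι).PairwiseDisjoint G')
    (hRF : ∀ k ∈ s, Disjoint Rst (F' k)) (hRG : ∀ k ∈ s, Disjoint Rst (G' k)) :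
    selfEnergy (Rst ∪ s.biUnion F') - selfEnergy (Rst ∪ s.biUnion G') =
      ∑ k ∈ s, (selfEnergy (F' k) + pairSum (F' k) Rst - selfEnergy (G' k) - pairSum (G' k) Rst) +
        1 / 2 * ∑ k ∈ s, ∑ l ∈ s.erase k, (pairSum (F' k) (F' l) - pairSum (G' k) (G' l)) := by
  have hdF : Disjoint Rst (s.biUnion F') := (Finset.disjoint_biUnion_right _ _ _).2 hRF
  have hdG : Disjoint Rst (s.biUnion G') := (Finset.disjoint_biUnion_right _ _ _).2 hRG
  rw [selfEnergy_union hdF, selfEnergy_union hdG, selfEnergy_biUnion s F' hF, selfEnergy_biUnion s G' hG,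
    pairSum_biUnion_right _ s F' hF, pairSum_biUnion_right _ s G' hG]
  simp only [Finset.sum_sub_distrib, Finset.sum_add_distrib]
  have e1 : ∀ k ∈ s, pairSum Rst (F' k) = pairSum (F' k) Rst := fun k _ => pairSum_comm _ _
  have e2 : ∀ k ∈ s, pairSum Rst (G' k) = pairSum (G' k) Rst := fun k _ => pairSum_comm _ _
  rw [Finset.sum_congr rfl e1, Finset.sum_congr rfl e2]
  ring

/-! ## §3  From the `Y`-gain to the finite gain: splitting the tails -/

/-- the field of `Y ∖ A` at `a` splits into the finite part over `F ∖ A` and the tail over `Y ∖ F` (`A ⊆ F ⊆ Y`, `Y` uniformly discrete). -/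
theorem tsum_sdiff_split {Y : Set (EuclideanSpace ℝ (Fin 3))} (hY : UniformlyDiscrete Y) {A F : Finset (EuclideanSpace ℝ (Fin 3))} (hAF : A ⊆ F) (hFY : (↑F : Set (EuclideanSpace ℝ (Fin 3))) ⊆ Y) (a : (EuclideanSpace ℝ (Fin 3))) :
    ∑' w : ↥(Y \ ↑A), lennardJones (dist a (w : (EuclideanSpace ℝ (Fin 3)))) =
      ∑ b ∈ F \ A, lennardJones (dist a b) + ∑' w : ↥(Y \ ↑F), lennardJones (dist a (w : (EuclideanSpace ℝ (Fin 3)))) := by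
  classical
  have hset : Y \ (↑A : Set (EuclideanSpace ℝ (Fin 3))) = ↑(F \ A) ∪ (Y \ ↑F) := by
    ext w
    simp only [Set.mem_sdiff, Finset.mem_coe, Set.mem_union, Finset.mem_sdiff]
    constructor
    · intro ⟨hwY, hwA⟩
      by_cases hwF : w ∈ F
      · exact Or.inl ⟨hwF, hwA⟩
      · exact Or.inr ⟨hwY, hwF⟩
    · rintro (⟨hwF, hwA⟩ | ⟨hwY, hwF⟩)
      · exact ⟨hFY (Finset.mem_coe.2 hwF), hwA⟩
      · exact ⟨hwY, fun hwA => hwF (hAF hwA)⟩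
  have hdisj : Disjoint (↑(F \ A) : Set (EuclideanSpace ℝ (Fin 3))) (Y \ ↑F) := by
    rw [Set.disjoint_left]
    intro w hw hw'
    exact hw'.2 (Finset.mem_coe.2 (Finset.mem_sdiff.1 (Finset.mem_coe.1 hw)).1)
  have hs1 : Summable ((fun w : (EuclideanSpace ℝ (Fin 3)) => lennardJones (dist a w)) ∘ (↑) : (↑(F \ A) : Set (EuclideanSpace ℝ (Fin 3))) → ℝ) :=
    (hY.mono ((Finset.coe_subset.2 Finset.sdiff_subset).trans hFY)).summable_lennardJones a
  have hs2 : Summable ((fun w : (EuclideanSpace ℝ (Fin 3)) => lennardJones (dist a w)) ∘ (↑) : (Y \ ↑F : Set (EuclideanSpace ℝ (Fin 3))) → ℝ) :=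
    (hY.mono Set.sdiff_subset).summable_lennardJones a
  have hfin : ∑' w : ↥(↑(F \ A) : Set (EuclideanSpace ℝ (Fin 3))), lennardJones (dist a (w : (EuclideanSpace ℝ (Fin 3)))) = ∑ b ∈ F \ A, lennardJones (dist a b) :=
    Finset.tsum_subtype' (F \ A) (fun w => lennardJones (dist a w))
  rw [hset, Summable.tsum_union_disjoint hdisj hs1 hs2, hfin]

/-- **gain comparison.** For a surgery `(A, B)` with `A ⊆ F ⊆ Y` (`F` finite), the finite gain inside `F` differs from `surgeryGain Y A B` exactly
by the tails over `Y ∖ F`: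
`U(A) + I(A, F∖A) − U(B) − I(B, F∖A) = surgeryGain Y A B − Σ_{a∈A} tail(a) + Σ_{b∈B} tail(b)`. -/
theorem finiteGain_eq {Y : Set (EuclideanSpace ℝ (Fin 3))} (hY : UniformlyDiscrete Y) {A F : Finset (EuclideanSpace ℝ (Fin 3))} (B : Finset (EuclideanSpace ℝ (Fin 3))) (hAF : A ⊆ F)
    (hFY : (↑F : Set (EuclideanSpace ℝ (Fin 3))) ⊆ Y) :
    selfEnergy A + pairSum A (F \ A) - selfEnergy B - pairSum B (F \ A) =
      surgeryGain Y A B - ∑ a ∈ A, ∑' w : ↥(Y \ ↑F), lennardJones (dist a (w : (EuclideanSpace ℝ (Fin 3)))) +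
        ∑ b ∈ B, ∑' w : ↥(Y \ ↑F), lennardJones (dist b (w : (EuclideanSpace ℝ (Fin 3)))) := by
  have hA : ∀ a ∈ A, ∑' w : ↥(Y \ ↑A), lennardJones (dist a (w : (EuclideanSpace ℝ (Fin 3)))) =
      ∑ b ∈ F \ A, lennardJones (dist a b) + ∑' w : ↥(Y \ ↑F), lennardJones (dist a (w : (EuclideanSpace ℝ (Fin 3)))) :=
    fun a _ => tsum_sdiff_split hY hAF hFY a
  have hB : ∀ b ∈ B, ∑' w : ↥(Y \ ↑A), lennardJones (dist b (w : (EuclideanSpace ℝ (Fin 3)))) =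
      ∑ b' ∈ F \ A, lennardJones (dist b b') + ∑' w : ↥(Y \ ↑F), lennardJones (dist b (w : (EuclideanSpace ℝ (Fin 3)))) :=
    fun b _ => tsum_sdiff_split hY hAF hFY b
  unfold surgeryGain
  rw [Finset.sum_congr rfl hA, Finset.sum_congr rfl hB, Finset.sum_add_distrib, Finset.sum_add_distrib]
  simp only [selfEnergy, pairSum]
  ring

/-! ## §4  The abstract superposition estimate -/

/-- `F ∖ F'_k = (F ∖ ⋃ F') ∪ ⋃_{l ≠ k} F'_l` for a disjoint family inside `F`. -/
theorem sdiff_eq_rest_union {ι : Type*} [DecidableEq ι] (s : Finset ι) (F : Finset (EuclideanSpace ℝ (Fin 3))) (F' : ι → Finset (EuclideanSpace ℝ (Fin 3)))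
    (hF'F : ∀ k ∈ s, F' k ⊆ F) (hF : (↑s : Set ι).PairwiseDisjoint F') {k : ι} (hk : k ∈ s) :
    F \ F' k = (F \ s.biUnion F') ∪ (s.erase k).biUnion F' := by
  ext x
  simp only [Finset.mem_sdiff, Finset.mem_union, Finset.mem_biUnion, Finset.mem_erase, not_exists, not_and]
  constructor
  · rintro ⟨hxF, hxk⟩
    by_cases hU : ∃ l ∈ s, x ∈ F' l
    · obtain ⟨l, hl, hxl⟩ := hU
      exact Or.inr ⟨l, ⟨fun hlk => hxk (hlk ▸ hxl), hl⟩, hxl⟩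
    · simp only [not_exists, not_and] at hU
      exact Or.inl ⟨hxF, hU⟩
  · rintro (⟨hxF, hU⟩ | ⟨l, ⟨hlk, hl⟩, hxl⟩)
    · exact ⟨hxF, hU k hk⟩
    · refine ⟨hF'F l hl hxl, fun hxk => ?_⟩
      exact (Finset.disjoint_left.1 (hF hl hk hlk) hxl) hxk

/-- the surgered configuration has the same number of atoms. -/
theorem card_surgered {ι : Type*} [DecidableEq ι] {Y : Set (EuclideanSpace ℝ (Fin 3))} (s : Finset ι) (F : Finset (EuclideanSpace ℝ (Fin 3))) (hFY : (↑F : Set (EuclideanSpace ℝ (Fin 3))) ⊆ Y)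
    (F' G' : ι → Finset (EuclideanSpace ℝ (Fin 3))) (hF'F : ∀ k ∈ s, F' k ⊆ F) (hF : (↑s : Set ι).PairwiseDisjoint F')
    (hG : (↑s : Set ι).PairwiseDisjoint G') (hGY : ∀ k ∈ s, Disjoint (↑(G' k) : Set (EuclideanSpace ℝ (Fin 3))) (Y \ ↑(F' k)))
    (hcard : ∀ k ∈ s, (G' k).card = (F' k).card) :
    ((F \ s.biUnion F') ∪ s.biUnion G').card = F.card := by
  have hRG : Disjoint (F \ s.biUnion F') (s.biUnion G') := by
    rw [Finset.disjoint_biUnion_right]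
    intro k hk
    rw [Finset.disjoint_left]
    intro x hx hxG
    rw [Finset.mem_sdiff] at hx
    have hxU : x ∉ F' k := fun h => hx.2 (Finset.mem_biUnion.2 ⟨k, hk, h⟩)
    exact Set.disjoint_left.1 (hGY k hk) (Finset.mem_coe.2 hxG) ⟨hFY (Finset.mem_coe.2 hx.1), fun h => hxU (Finset.mem_coe.1 h)⟩
  have hUF : s.biUnion F' ⊆ F := Finset.biUnion_subset.2 hF'F
  rw [Finset.card_union_of_disjoint hRG, Finset.card_sdiff_of_subset hUF, Finset.card_biUnion hF, Finset.card_biUnion hG,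
    Finset.sum_congr rfl hcard]
  have : ∑ k ∈ s, (F' k).card ≤ F.card := by
    rw [← Finset.card_biUnion hF]; exact Finset.card_le_card hUF
  omega

/-- `|I(A, B)| ≤ #A · β` when every row is bounded by `β`. -/
theorem abs_pairSum_le {A B : Finset (EuclideanSpace ℝ (Fin 3))} {β : ℝ} (h : ∀ a ∈ A, ∑ b ∈ B, |lennardJones (dist a b)| ≤ β) :
    |pairSum A B| ≤ A.card * β := by
  unfold pairSum
  calc |∑ a ∈ A, ∑ b ∈ B, lennardJones (dist a b)| ≤ ∑ a ∈ A, |∑ b ∈ B, lennardJones (dist a b)| := Finset.abs_sum_le_sum_abs _ _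
    _ ≤ ∑ a ∈ A, ∑ b ∈ B, |lennardJones (dist a b)| := Finset.sum_le_sum fun a _ => Finset.abs_sum_le_sum_abs _ _
    _ ≤ ∑ a ∈ A, β := Finset.sum_le_sum h
    _ = A.card * β := by rw [Finset.sum_const, nsmul_eq_mul]

/-- **The abstract superposition estimate.**  A disjoint family of count-preserving surgeries `(F'_k, G'_k)_{k ∈ s}` inside a finite
`F ⊆ Y`, each releasing `≥ g` in `Y`, with exterior tails `≤ γ` per atom, cross rows `≤ β k l` per atom and `#F'_k ≤ M₀`, such that
`M₀ (2γ + 2 Σ_{l ≠ k} β k l) ≤ g/2`, certifies `E(#F) + #s · g/2 ≤ U(F)`: the surgered configuration has `#F` atoms and energy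
`≤ U(F) − #s · g/2` (exact bookkeeping `selfEnergy_family_sub` + `finiteGain_eq`, then the bounds). -/
theorem superpose_estimate {ι : Type*} [DecidableEq ι] {Y : Set (EuclideanSpace ℝ (Fin 3))} (hY : UniformlyDiscrete Y) (s : Finset ι) (F : Finset (EuclideanSpace ℝ (Fin 3)))
    (hFY : (↑F : Set (EuclideanSpace ℝ (Fin 3))) ⊆ Y) (F' G' : ι → Finset (EuclideanSpace ℝ (Fin 3))) (hF'F : ∀ k ∈ s, F' k ⊆ F) (hF : (↑s : Set ι).PairwiseDisjoint F')
    (hG : (↑s : Set ι).PairwiseDisjoint G') (hGY : ∀ k ∈ s, Disjoint (↑(G' k) : Set (EuclideanSpace ℝ (Fin 3))) (Y \ ↑(F' k)))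
    (hcard : ∀ k ∈ s, (G' k).card = (F' k).card) {g γ M₀ : ℝ} {β : ι → ι → ℝ} (hγ : 0 ≤ γ) (hβ : ∀ k l, 0 ≤ β k l)
    (hgain : ∀ k ∈ s, g ≤ surgeryGain Y (F' k) (G' k)) (hM : ∀ k ∈ s, ((F' k).card : ℝ) ≤ M₀)
    (htailF : ∀ k ∈ s, ∀ a ∈ F' k, |∑' w : ↥(Y \ ↑F), lennardJones (dist a (w : (EuclideanSpace ℝ (Fin 3))))| ≤ γ)
    (htailG : ∀ k ∈ s, ∀ a ∈ G' k, |∑' w : ↥(Y \ ↑F), lennardJones (dist a (w : (EuclideanSpace ℝ (Fin 3))))| ≤ γ)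
    (hβFF : ∀ k ∈ s, ∀ l ∈ s, k ≠ l → ∀ a ∈ F' k, ∑ b ∈ F' l, |lennardJones (dist a b)| ≤ β k l)
    (hβGF : ∀ k ∈ s, ∀ l ∈ s, k ≠ l → ∀ a ∈ G' k, ∑ b ∈ F' l, |lennardJones (dist a b)| ≤ β k l)
    (hβGG : ∀ k ∈ s, ∀ l ∈ s, k ≠ l → ∀ a ∈ G' k, ∑ b ∈ G' l, |lennardJones (dist a b)| ≤ β k l)
    (herr : ∀ k ∈ s, M₀ * (2 * γ + 2 * ∑ l ∈ s.erase k, β k l) ≤ g / 2) :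
    groundStateEnergy lennardJones 3 F.card + s.card * (g / 2) ≤ selfEnergy F := by
  set Rst : Finset (EuclideanSpace ℝ (Fin 3)) := F \ s.biUnion F' with hRst
  set X : Finset (EuclideanSpace ℝ (Fin 3)) := Rst ∪ s.biUnion G' with hX
  have hUF : s.biUnion F' ⊆ F := Finset.biUnion_subset.2 hF'F
  have hFdec : F = Rst ∪ s.biUnion F' := (Finset.sdiff_union_of_subset hUF).symm
  have hXcard : X.card = F.card := card_surgered s F hFY F' G' hF'F hF hG hGY hcard
  -- `E(#F) ≤ U(X)`
  have hEX : groundStateEnergy lennardJones 3 F.card ≤ selfEnergy X := by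
    rw [← hXcard, selfEnergy, ← interactionEnergy_enum X]
    exact groundStateEnergy_lennardJones_le (enum_injective X)
  -- disjointness of the rest from both families
  have hRF : ∀ k ∈ s, Disjoint Rst (F' k) := fun k hk =>
    Finset.disjoint_of_subset_right (Finset.subset_biUnion_of_mem F' hk) Finset.sdiff_disjoint
  have hRG : ∀ k ∈ s, Disjoint Rst (G' k) := by
    intro k hk
    rw [Finset.disjoint_left]
    intro x hx hxG
    rw [hRst, Finset.mem_sdiff] at hx
    have hxU : x ∉ F' k := fun h => hx.2 (Finset.mem_biUnion.2 ⟨k, hk, h⟩)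
    exact Set.disjoint_left.1 (hGY k hk) (Finset.mem_coe.2 hxG) ⟨hFY (Finset.mem_coe.2 hx.1), fun h => hxU (Finset.mem_coe.1 h)⟩
  have hident := selfEnergy_family_sub s Rst F' G' hF hG hRF hRG
  rw [← hFdec] at hident
  -- per-cell identity
  have hcell : ∀ k ∈ s, selfEnergy (F' k) + pairSum (F' k) Rst - selfEnergy (G' k) - pairSum (G' k) Rst =
      surgeryGain Y (F' k) (G' k) - ∑ a ∈ F' k, ∑' w : ↥(Y \ ↑F), lennardJones (dist a (w : (EuclideanSpace ℝ (Fin 3)))) +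
        ∑ b ∈ G' k, ∑' w : ↥(Y \ ↑F), lennardJones (dist b (w : (EuclideanSpace ℝ (Fin 3)))) -
        ∑ l ∈ s.erase k, pairSum (F' k) (F' l) + ∑ l ∈ s.erase k, pairSum (G' k) (F' l) := by
    intro k hk
    have h1 := finiteGain_eq hY (G' k) (hF'F k hk) hFY
    have hsd := sdiff_eq_rest_union s F F' hF'F hF hk
    have hdj : Disjoint Rst ((s.erase k).biUnion F') :=
      (Finset.disjoint_biUnion_right _ _ _).2 fun l hl => hRF l (Finset.mem_of_mem_erase hl)
    have hFe : (↑(s.erase k) : Set ι).PairwiseDisjoint F' := hF.subset (Finset.coe_subset.2 (Finset.erase_subset k s))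
    have e1 : pairSum (F' k) (F \ F' k) = pairSum (F' k) Rst + ∑ l ∈ s.erase k, pairSum (F' k) (F' l) := by
      rw [hsd, pairSum_union_right _ hdj, pairSum_biUnion_right _ _ F' hFe]
    have e2 : pairSum (G' k) (F \ F' k) = pairSum (G' k) Rst + ∑ l ∈ s.erase k, pairSum (G' k) (F' l) := by
      rw [hsd, pairSum_union_right _ hdj, pairSum_biUnion_right _ _ F' hFe]
    rw [e1, e2] at h1
    linarith
  -- per-cell lower bound
  have hlow : ∀ k ∈ s, g / 2 ≤ (selfEnergy (F' k) + pairSum (F' k) Rst - selfEnergy (G' k) - pairSum (G' k) Rst) +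
      1 / 2 * ∑ l ∈ s.erase k, (pairSum (F' k) (F' l) - pairSum (G' k) (G' l)) := by
    intro k hk
    rw [hcell k hk]
    have hMk := hM k hk
    have hMk' : ((G' k).card : ℝ) ≤ M₀ := by rw [hcard k hk]; exact hMk
    have hM0 : 0 ≤ M₀ := le_trans (Nat.cast_nonneg _) hMk
    have tF : |∑ a ∈ F' k, ∑' w : ↥(Y \ ↑F), lennardJones (dist a (w : (EuclideanSpace ℝ (Fin 3))))| ≤ M₀ * γ :=
      (Finset.abs_sum_le_sum_abs _ _).trans (((Finset.sum_le_sum (htailF k hk)).trans_eq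
        (by rw [Finset.sum_const, nsmul_eq_mul])).trans (mul_le_mul_of_nonneg_right hMk hγ))
    have tG : |∑ b ∈ G' k, ∑' w : ↥(Y \ ↑F), lennardJones (dist b (w : (EuclideanSpace ℝ (Fin 3))))| ≤ M₀ * γ :=
      (Finset.abs_sum_le_sum_abs _ _).trans (((Finset.sum_le_sum (htailG k hk)).trans_eq
        (by rw [Finset.sum_const, nsmul_eq_mul])).trans (mul_le_mul_of_nonneg_right hMk' hγ))
    have cFF : ∀ l ∈ s.erase k, |pairSum (F' k) (F' l)| ≤ M₀ * β k l := fun l hl =>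
      (abs_pairSum_le (hβFF k hk l (Finset.mem_of_mem_erase hl) (Finset.ne_of_mem_erase hl).symm)).trans
        (mul_le_mul_of_nonneg_right hMk (hβ k l))
    have cGF : ∀ l ∈ s.erase k, |pairSum (G' k) (F' l)| ≤ M₀ * β k l := fun l hl =>
      (abs_pairSum_le (hβGF k hk l (Finset.mem_of_mem_erase hl) (Finset.ne_of_mem_erase hl).symm)).trans
        (mul_le_mul_of_nonneg_right hMk' (hβ k l))
    have cGG : ∀ l ∈ s.erase k, |pairSum (G' k) (G' l)| ≤ M₀ * β k l := fun l hl =>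
      (abs_pairSum_le (hβGG k hk l (Finset.mem_of_mem_erase hl) (Finset.ne_of_mem_erase hl).symm)).trans
        (mul_le_mul_of_nonneg_right hMk' (hβ k l))
    have sFF : |∑ l ∈ s.erase k, pairSum (F' k) (F' l)| ≤ M₀ * ∑ l ∈ s.erase k, β k l := by
      rw [Finset.mul_sum]; exact (Finset.abs_sum_le_sum_abs _ _).trans (Finset.sum_le_sum cFF)
    have sGF : |∑ l ∈ s.erase k, pairSum (G' k) (F' l)| ≤ M₀ * ∑ l ∈ s.erase k, β k l := by
      rw [Finset.mul_sum]; exact (Finset.abs_sum_le_sum_abs _ _).trans (Finset.sum_le_sum cGF)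
    have sGG : |∑ l ∈ s.erase k, pairSum (G' k) (G' l)| ≤ M₀ * ∑ l ∈ s.erase k, β k l := by
      rw [Finset.mul_sum]; exact (Finset.abs_sum_le_sum_abs _ _).trans (Finset.sum_le_sum cGG)
    have hg := hgain k hk
    have he := herr k hk
    rw [Finset.sum_sub_distrib]
    rw [abs_le] at tF tG sFF sGF sGG
    obtain ⟨tF1, tF2⟩ := tF; obtain ⟨tG1, tG2⟩ := tG; obtain ⟨s1, s2⟩ := sFF; obtain ⟨s3, s4⟩ := sGF; obtain ⟨s5, s6⟩ := sGG
    linarith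
  -- sum over the cells
  have hsum : (s.card : ℝ) * (g / 2) ≤ selfEnergy F - selfEnergy X := by
    rw [hX, hident]
    have := Finset.sum_le_sum hlow
    rw [Finset.sum_const, nsmul_eq_mul, Finset.sum_add_distrib, ← Finset.mul_sum] at this
    exact this
  linarith

end Summit.AtomisticToContinuum.Crystallization.Theorems.OverbindingBudgetLocalRelaxationCut

end
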